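import Literature.MathematicalPhysics.QuantumFieldTheory.Balaban1983to89.B6GOneLevelV1Bridge
import Literature.MathematicalPhysics.QuantumFieldTheory.Balaban1983to89.B5Hk163TorusHolderRate
import Literature.MathematicalPhysics.QuantumFieldTheory.Balaban1983to89.B5TowerOneStroke
import Literature.MathematicalPhysics.QuantumFieldTheory.Balaban1983to89.B5G183FreeRowSum
import Summits.QuantumFields.YangMills.Theorems.UnitScaleTiltProp7FlatCoercivityR
import Summits.QuantumFields.YangMills.Theorems.UnitScaleTiltProp8FlatPropagatorGrad
import HarnessLib

/-!
# Route `UnitScaleTilt`, crux K1 child «MinimiserStabilityRegPr» (stmt-QuantumFields-19200), leaves V2′ (one-step halving, Sect. F) and V3 (Prop. 7):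
# **PRINT'S MINIMAL-EXTENSION OPERATOR `H` ([Balaban1984PropagatorsI] (1.63) `H_k`; [Balaban1985Variational] (45)–(46)) AT THE SETUP TORUS, FLAT, BY BRIDGE:
# `Q_j(Hb) = b`, `|Hb| ≤ C(d)|b|`, `L^j·|∇(Hb)| ≤ C(d)|b|` — uniform in the level, in `L` and in the volume; instance at the d = 3 carrier**

Cell `ym3-torus` (HUMAN RULING D-0037, YM ladder rung R3), seat `ym3-torus-p1` gen 14 (UV side); memo HOME/UV3-NODE.md §23.  `--supports
stmt-QuantumFields-19200 --as helper`.  Fourth file of the flat-operator bridge (pillar F3 of OWNER RULING g20-№8 §A: «F3 = flat-operator bridge»; the F4 pen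
takes «abstract flat-operator data (H, G carrying [B6] (2.47)–(2.51)-type bounds as hypotheses)» — files `…FlatPropagatorSup/Prop12/Grad` discharge the `G` side,
THIS file the `H` side).  [Balaban1985Variational] p. 285: *«L^jηQ_jHB = B, … |HB| ≦ B₀(L^jη)⁻¹|B|, |∇HB| ≦ B₀(L^jη)⁻²|B| (46) … B₀ depends on d only»*; Sect. F
p. 302 uses `HB` with FLAT operators ((157)–(161)).  pub-balaban has [B5]'s `H_k` as a typed torus matrix with kernel certificates: `B5Hk163Torus.HkOp` (1.63),
`QvOp_HkOp_mulVec` («Q_kH_kB = B»), `norm_HkOp_mulVec_le` (n-uniform exponential kernel decay), `B5Hk163TorusHolder.fdiff_HkOp_mulVec` + `B5Hk163TorusHolderDecay.norm_dker_bpt_le`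
(the kernel of `∂_νH_k` decays, n-uniform), and p21's `B5TowerOneStroke.Qk_pullR_HkOp` (the real part of `H_k b̃` averages to `b` on the tower); p16's `B5Eq117TorusCarriers.Qk_tV`
identifies the tower average with the V1 `bondAvgIter`.  THIS FILE COMPOSES THEM (no analysis re-proved):
* §1 `exists_EK_eq_bpt_rep` (every fine site is a block point over the representative of its block), `tV_symm_pullR_apply` (values of the pulled-back field:
  `(Hb)(c) = Re (H_k b̃)(EK c₋, μ(c))`, `b̃ = cplx (tB b)`).
* §2 **`bondAvgIter_H_eq`** — `Q_j(Hb) = b` for `Hb := tV⁻¹(pullR(H_k·b̃))`, EVERY `P : Params`, every `j ≤ m + K`.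
* §3 `sum_sum_exp_mul_le` (coarse-torus sum `≤ (d+1)K_{d+1}(κ)`), **`abs_H_le`** (`|(Hb)(c)| ≤ C_H(P.d)·β` for `|b| ≤ β`), **`abs_grad_H_le`**
  (`L^j·|(Hb)(⟨s+e_ν,μ⟩) − (Hb)(⟨s,μ⟩)| ≤ C_∇(P.d)·β`), `C_H(d) = M_G(d)C_per(κ₁₆₃(d),d−1)·dK_d(κ₁₆₃(d)/d)`, `C_∇(d)` the same with `M_D(d)` — functions of `d` ALONE
  (b05's `d+1` statements reached for general `P` by `cases P`).
* §4 **`exists_flatH`** (every `Params` of dimension `d`: `∃ C > 0, ∀ P, P.d = d → ∀ j ≤ m+K, ∃ H, ∀ b, Q_j(Hb) = b ∧ (|b| ≤ β → |Hb| ≤ Cβ ∧ L^j|∇Hb| ≤ Cβ)`) and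
  **`exists_flatH_T3`** (d = 3 carrier: ABSOLUTE `C`, every `F`, `n`, `K`, `j = K − n`).
HONEST SCOPE.  (i) `U = 1` (flat) — the operator Sect. F uses; the covariant `H(U₀)` of [Balaban1985BackgroundPropagators] is not touched; (ii) `H` here is print's
LANDAU-gauge minimiser of [B5] (`R∂*H_kB = 0` and the minimum property are pub-balaban's `B5HkOpLandauMin`/`B5TowerOneStroke.isLeast_actionEta_HkOp` and are NOT
re-read in V1 letters here); (iii) decay of `H`'s kernel (localized form) not re-read (available: `norm_HkOp_mulVec_le`); (iv) constants crude (pub-balaban's), `d`-only as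
printed; (v) the item's own right inverses of `bondAvgIter` (★ym-ust-19200-p1: tent `Prop7LineAvgRightInverse`, smooth tent in progress) are DIFFERENT operators with the
same role — this file is complementary, not a replacement.  No definition, no sorry, standard axioms.  NOT a claim about the mass gap.

References: T. Bałaban, CMP **95** (1984) 17–40 [Balaban1984PropagatorsI] (1.63) p.28, p.29 (properties of `H_k`, bounds on `∂_ν(H_kB)`); CMP **102** (1985) 277–309
[Balaban1985Variational] (45)–(46) p.285, Sect. F (157)–(161) p.302; CMP **102** (1985) 255–275 [Balaban1985UV3] (1)–(3) p.256 (the family).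
-/

set_option autoImplicit false

noncomputable section

open scoped BigOperators InnerProductSpace Matrix ComplexConjugate

namespace Summit.QuantumFields.YangMills.Theorems.FlatMinimizerH

open Literature.MathematicalPhysics.QuantumFieldTheory.Balaban1983to89
open Literature.MathematicalPhysics.QuantumFieldTheory.BalabanImbrieJaffe1984to88.BIJ85AxialPropagator411 (BondSpace)
open LatticeFieldCalculus B6GOneLevelV1Bridge
open B5Eq117TorusCarriers (Mk EK eK tV tB tV_symm_apply tB_apply Qk_tV EK_blockSiteK blockSiteK blockEquivK eK_shift)
open B5Eq118OneStroke (iterBlock iterBlockOf mem_iterBlock)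
open B5Prop11Plancherel (Tor fine unitVec fdiff)
open B5SectBStatements (Fld Qk cplx)
open B5TowerOneStroke (towerE towerE_eq pullR pullR_apply Qk_pullR_HkOp)
open B5Block118 (bpt)
open B5Hk163Torus (HkOp norm_HkOp_mulVec_le)
open B5Hk163TorusHolder (dker fdiff_HkOp_mulVec)
open B5Hk163TorusHolderDecay (MD163 norm_dker_bpt_le CHolder163_nonneg)
open B5Hk163TorusHolderRate (sum_exp_torusSupNorm_sub_rep_le)
open B5Hk163Decay (MG163 MG163_nonneg)
open B5Hk163Strip (kappa163 kappa163_pos)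
open B4TorusKernel (periodConst)
open B4TorusKernel.MultiPeriod (torusSupNorm)
open B5Kernel166Decay (periodConst_pos)
open B6LowerBound2153Torus (toT rep toT_rep)
open B4Sect5Proof (latticeConst latticeConst_nonneg)
open B5G183FreeRowSum (fdiff_mulVec)

variable {P : Params} {j : ℕ}

/-! ## §1 Dictionary -/

/-- every fine site is a block point of its `j`-block, with an integer representative of the block: `EK s = bpt (toT (rep y)) r`,
`y = ` the `j`-fold block point of `s`. [cite: Balaban1984PropagatorsI, (1.6) p.18, (1.18) p.20] -/
theorem exists_EK_eq_bpt_rep (hj : j ≤ P.m + P.K) (s : Site P 0) :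
    ∃ r : Fin P.d → Fin (P.L ^ j), EK hj s = bpt (P.L ^ j) (Mk P j) (toT (Mk P j) (rep (Mk P j) (iterBlockOf j s))) r := by
  have hs : s ∈ iterBlock j (iterBlockOf j s) := (mem_iterBlock j _ s).2 rfl
  refine ⟨(blockEquivK hj (iterBlockOf j s)).symm ⟨s, hs⟩, ?_⟩
  have h : blockSiteK j (iterBlockOf j s) ((blockEquivK hj (iterBlockOf j s)).symm ⟨s, hs⟩) = s :=
    congrArg Subtype.val ((blockEquivK hj (iterBlockOf j s)).apply_symm_apply ⟨s, hs⟩)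
  rw [toT_rep, ← EK_blockSiteK hj, h]

/-- values of the pulled-back tower field: `(tV⁻¹(pullR A′))(c) = Re A′(EK c₋, μ(c))` (p16's `tV_symm_apply`, p21's `pullR_apply`, `EK = towerE ∘ eK`).
[cite: Balaban1984PropagatorsI, (1.17)-(1.18) p.20] -/
theorem tV_symm_pullR_apply (hj : j ≤ P.m + P.K) (A' : Tor (fine (P.L ^ j) (Mk P j)) × Fin P.d → ℂ) (c : PBond P 0) :
    (tV hj).symm (pullR P.L (Mk P j) j A') c = (A' (EK hj c.src, c.dir)).re := by
  rw [tV_symm_apply]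
  rfl

/-! ## §2 Print's `H_k` pulled back to the Setup torus: `Q_j H = 1` -/

/-- **`Q_j (H b) = b` AT THE SETUP TORUS, EVERY `Params`**: the V1 field `H b := tV⁻¹ (pullR (H_k · b̃))` — the real part of pub-balaban's typed `H_k` of
[B5] (1.63) (`B5Hk163Torus.HkOp`, `n = L^j`, coarse torus `Mk P j`) applied to the complexified coarse field `b̃ = cplx (tB b)` — averages back to `b`
under the `j`-fold straight-line block average `bondAvgIter j` (p21's `Qk_pullR_HkOp` «Q_kH_kB = B» + p16's `Qk_tV`).
[cite: Balaban1984PropagatorsI, p.29 after (1.63) «Q_kH_kB = B»; Balaban1985Variational, (45) p.285] -/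
theorem bondAvgIter_H_eq (hj : j ≤ P.m + P.K) (b : VecField P j ℝ) :
    bondAvgIter j ((tV hj).symm (pullR P.L (Mk P j) j (HkOp (P.L ^ j) (Mk P j) *ᵥ cplx (tB b)))) = b := by
  haveI : NeZero P.L := ⟨P.L_pos.ne'⟩
  have h1 := Qk_tV hj ((tV hj).symm (pullR P.L (Mk P j) j (HkOp (P.L ^ j) (Mk P j) *ᵥ cplx (tB b))))
  rw [LinearEquiv.apply_symm_apply] at h1
  have h2 : Qk P.L (Mk P j) j (pullR P.L (Mk P j) j (HkOp (P.L ^ j) (Mk P j) *ᵥ cplx (tB b))) = tB b :=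
    Qk_pullR_HkOp P.L (Mk P j) j (tB b)
  exact tB.injective (h1.symm.trans h2)

/-! ## §3 The sup bound «|HB| ≤ B₀|B|» and the gradient bound «|∇HB| ≤ B₀|B|» (η-units), constants functions of `d` alone -/

/-- the torus sum of the decay factor over the coarse torus, with the `Fin (d+1)`-component sum: `Σ_y Σ_λ e^{−κ|x′−ỹ|}·c ≤ (d+1)·K_{d+1}(κ)·c`
for `c ≥ 0`. [cite: Balaban1984PropagatorsI, (1.115) p.36 («imply immediately»)] -/
theorem sum_sum_exp_mul_le {d : ℕ} (M : Fin (d + 1) → ℕ) [∀ μ, NeZero (M μ)] {a : ℝ} (ha : 0 < a) (x' : Fin (d + 1) → ℤ)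
    {c : ℝ} (hc : 0 ≤ c) :
    ∑ y : Tor M, ∑ _lam : Fin (d + 1), Real.exp (-(a * torusSupNorm M (x' - rep M y))) * c
      ≤ (d + 1) * latticeConst (d + 1) a * c := by
  have h := sum_exp_torusSupNorm_sub_rep_le M ha x'
  calc ∑ y : Tor M, ∑ _lam : Fin (d + 1), Real.exp (-(a * torusSupNorm M (x' - rep M y))) * c
      = (d + 1) * ((∑ y : Tor M, Real.exp (-(a * torusSupNorm M (x' - rep M y)))) * c) := by
        simp only [Finset.sum_const, Finset.card_univ, Fintype.card_fin, nsmul_eq_mul, Nat.cast_add, Nat.cast_one]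
        rw [Finset.sum_mul, Finset.mul_sum]
    _ ≤ (d + 1) * (latticeConst (d + 1) a * c) :=
        mul_le_mul_of_nonneg_left (mul_le_mul_of_nonneg_right h hc) (by positivity)
    _ = (d + 1) * latticeConst (d + 1) a * c := by ring

/-- **«|HB| ≤ B₀|B|» AT THE SETUP TORUS, EVERY `Params`, `B₀ = B₀(d)`**: for every real coarse bond field `b` with `|b| ≤ β` and every fine bond `c`,
`|(H b)(c)| ≤ C_H(d)·β`, `C_H(d) = M_G(d)·C_per(κ₁₆₃(d), d−1)·d·K_d(κ₁₆₃(d)/d)` (pub-balaban's kernel decay `B5Hk163Torus.norm_HkOp_mulVec_le` summed over the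
coarse torus with `B5Hk163TorusHolderRate.sum_exp_torusSupNorm_sub_rep_le`) — uniform in the level `j`, in `L` and in the volume.
[cite: Balaban1984PropagatorsI, (1.63) p.28 and p.29; Balaban1985Variational, (46) p.285] -/
theorem abs_H_le (hj : j ≤ P.m + P.K) (b : VecField P j ℝ) {β : ℝ} (hb : ∀ c', |b c'| ≤ β) (c : PBond P 0) :
    |(tV hj).symm (pullR P.L (Mk P j) j (HkOp (P.L ^ j) (Mk P j) *ᵥ cplx (tB b))) c|
      ≤ MG163 P.d * periodConst (kappa163 P.d) (P.d - 1) * (P.d * latticeConst P.d (kappa163 P.d / P.d)) * β := by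
  rw [tV_symm_pullR_apply]
  obtain ⟨r, hr⟩ := exists_EK_eq_bpt_rep hj c.src
  rw [hr]
  obtain ⟨dP, L, m, K, hd, hL⟩ := P
  obtain ⟨d, rfl⟩ : ∃ d, dP = d + 1 := ⟨dP - 1, by omega⟩
  haveI : NeZero (L ^ j) := ⟨by have := hL.2; positivity⟩
  have hβ : 0 ≤ β := (abs_nonneg _).trans (hb ⟨iterBlockOf j c.src, c.dir⟩)
  have hκ : 0 < kappa163 (d + 1) / (d + 1) := div_pos (kappa163_pos _) (by positivity)
  refine (Complex.abs_re_le_norm _).trans ?_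
  refine (norm_HkOp_mulVec_le (L ^ j) (Mk (⟨d + 1, L, m, K, hd, hL⟩ : Params) j) (cplx (tB b)) c.dir r
    (rep (Mk (⟨d + 1, L, m, K, hd, hL⟩ : Params) j) (iterBlockOf j c.src)) (rep (Mk (⟨d + 1, L, m, K, hd, hL⟩ : Params) j))
    (toT_rep _)).trans ?_
  have hC : 0 ≤ MG163 (d + 1) * periodConst (kappa163 (d + 1)) d := mul_nonneg (MG163_nonneg _) (periodConst_pos (kappa163_pos _) _).le
  have hsum : ∑ y : Tor (Mk (⟨d + 1, L, m, K, hd, hL⟩ : Params) j), ∑ lam : Fin (d + 1),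
      Real.exp (-(kappa163 (d + 1) / (d + 1) *
        torusSupNorm (Mk (⟨d + 1, L, m, K, hd, hL⟩ : Params) j)
          (rep (Mk (⟨d + 1, L, m, K, hd, hL⟩ : Params) j) (iterBlockOf j c.src) - rep (Mk (⟨d + 1, L, m, K, hd, hL⟩ : Params) j) y))) *
        ‖cplx (tB b) (y, lam)‖
      ≤ (d + 1) * latticeConst (d + 1) (kappa163 (d + 1) / (d + 1)) * β := by
    refine le_trans (Finset.sum_le_sum fun y _ => Finset.sum_le_sum fun lam _ =>
      mul_le_mul_of_nonneg_left ?_ (Real.exp_pos _).le) (sum_sum_exp_mul_le _ hκ _ hβ)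
    show ‖(((tB b) (y, lam) : ℝ) : ℂ)‖ ≤ β
    rw [Complex.norm_real, Real.norm_eq_abs, tB_apply]
    exact hb _
  have := mul_le_mul_of_nonneg_left hsum hC
  simpa [mul_assoc, mul_comm, mul_left_comm] using this

/-- **«|∇HB| ≤ B₀|B|» AT THE SETUP TORUS, EVERY `Params`, `B₀ = B₀(d)`** (η-units: the difference quotient with the lattice factor `L^j = η⁻¹`): for every real
coarse bond field `b` with `|b| ≤ β`, every fine site `s`, directions `μ, ν`: `L^j·|(H b)(⟨s+e_ν, μ⟩) − (H b)(⟨s, μ⟩)| ≤ C_∇(d)·β`,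
`C_∇(d) = M_D(d)·C_per(κ₁₆₃(d), d−1)·d·K_d(κ₁₆₃(d)/d)` (pub-balaban's `∂_νH_k` kernel decay `B5Hk163TorusHolderDecay.norm_dker_bpt_le` summed over the coarse torus)
— uniform in `j`, `L`, volume. [cite: Balaban1984PropagatorsI, p.29 ll.1–2 («This implies bounds on … ∂_ν(H_kB)_μ»); Balaban1985Variational, (46) p.285] -/
theorem abs_grad_H_le (hj : j ≤ P.m + P.K) (b : VecField P j ℝ) {β : ℝ} (hb : ∀ c', |b c'| ≤ β) (s : Site P 0) (μ ν : Fin P.d) :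
    (P.L : ℝ) ^ j *
        |(tV hj).symm (pullR P.L (Mk P j) j (HkOp (P.L ^ j) (Mk P j) *ᵥ cplx (tB b))) ⟨s.shift ν, μ⟩
          - (tV hj).symm (pullR P.L (Mk P j) j (HkOp (P.L ^ j) (Mk P j) *ᵥ cplx (tB b))) ⟨s, μ⟩|
      ≤ MD163 P.d * periodConst (kappa163 P.d) (P.d - 1) * (P.d * latticeConst P.d (kappa163 P.d / P.d)) * β := by
  rw [tV_symm_pullR_apply, tV_symm_pullR_apply]
  -- the scaled difference is the real part of `∂_ν(H_k b̃)` at `(EK s, μ)`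
  have hdiff : (P.L : ℝ) ^ j *
        (((HkOp (P.L ^ j) (Mk P j) *ᵥ cplx (tB b)) (EK hj (s.shift ν), μ)).re
          - ((HkOp (P.L ^ j) (Mk P j) *ᵥ cplx (tB b)) (EK hj s, μ)).re)
      = ((fdiff (fine (P.L ^ j) (Mk P j)) ((P.L ^ j : ℕ) : ℂ) ν *ᵥ (HkOp (P.L ^ j) (Mk P j) *ᵥ cplx (tB b))) (EK hj s, μ)).re := by
    rw [fdiff_mulVec, FlatPropagatorGrad.EK_shift hj s ν]
    simp only [Complex.mul_re, Complex.sub_re, Complex.sub_im, Complex.natCast_re, Complex.natCast_im, zero_mul, sub_zero]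
    push_cast
    ring
  have hL0 : (0 : ℝ) < (P.L : ℝ) ^ j := pow_pos (Nat.cast_pos.2 P.L_pos) _
  have habs : ∀ t : ℝ, (P.L : ℝ) ^ j * |t| = |(P.L : ℝ) ^ j * t| := fun t => by rw [abs_mul, abs_of_pos hL0]
  dsimp only
  rw [habs, hdiff]
  refine (Complex.abs_re_le_norm _).trans ?_
  rw [fdiff_HkOp_mulVec]
  obtain ⟨r, hr⟩ := exists_EK_eq_bpt_rep hj s
  rw [hr]
  obtain ⟨dP, L, m, K, hd, hL⟩ := P
  obtain ⟨d, rfl⟩ : ∃ d, dP = d + 1 := ⟨dP - 1, by omega⟩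
  haveI : NeZero (L ^ j) := ⟨by have := hL.2; positivity⟩
  have hβ : 0 ≤ β := (abs_nonneg _).trans (hb ⟨iterBlockOf j s, μ⟩)
  have hκ : 0 < kappa163 (d + 1) / (d + 1) := div_pos (kappa163_pos _) (by positivity)
  have hC : 0 ≤ MD163 (d + 1) * periodConst (kappa163 (d + 1)) d :=
    mul_nonneg (by unfold MD163; exact mul_nonneg (pow_nonneg (Real.exp_pos _).le _) (CHolder163_nonneg (0 : Fin (d + 1)) le_rfl one_pos))
      (periodConst_pos (kappa163_pos _) _).le
  refine (norm_sum_le _ _).trans ?_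
  refine (Finset.sum_le_sum fun y _ => norm_sum_le _ _).trans ?_
  have hterm : ∀ (y : Tor (Mk (⟨d + 1, L, m, K, hd, hL⟩ : Params) j)) (lam : Fin (d + 1)),
      ‖dker (L ^ j) (Mk (⟨d + 1, L, m, K, hd, hL⟩ : Params) j) μ lam ν
          (bpt (L ^ j) (Mk (⟨d + 1, L, m, K, hd, hL⟩ : Params) j)
            (toT (Mk (⟨d + 1, L, m, K, hd, hL⟩ : Params) j) (rep (Mk (⟨d + 1, L, m, K, hd, hL⟩ : Params) j) (iterBlockOf j s))) r) y
        * cplx (tB b) (y, lam)‖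
      ≤ MD163 (d + 1) * periodConst (kappa163 (d + 1)) d *
          (Real.exp (-(kappa163 (d + 1) / (d + 1) *
            torusSupNorm (Mk (⟨d + 1, L, m, K, hd, hL⟩ : Params) j)
              (rep (Mk (⟨d + 1, L, m, K, hd, hL⟩ : Params) j) (iterBlockOf j s) - rep (Mk (⟨d + 1, L, m, K, hd, hL⟩ : Params) j) y))) * β) := by
    intro y lam
    rw [norm_mul, ← mul_assoc]
    refine mul_le_mul ?_ ?_ (norm_nonneg _) (mul_nonneg hC (Real.exp_pos _).le)
    · have h := norm_dker_bpt_le (L ^ j) (Mk (⟨d + 1, L, m, K, hd, hL⟩ : Params) j) μ lam ν r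
        (rep (Mk (⟨d + 1, L, m, K, hd, hL⟩ : Params) j) (iterBlockOf j s)) (rep (Mk (⟨d + 1, L, m, K, hd, hL⟩ : Params) j) y)
      rwa [toT_rep _ y] at h
    · show ‖(((tB b) (y, lam) : ℝ) : ℂ)‖ ≤ β
      rw [Complex.norm_real, Real.norm_eq_abs, tB_apply]
      exact hb _
  refine (Finset.sum_le_sum fun y _ => Finset.sum_le_sum fun lam _ => hterm y lam).trans ?_
  have hsum := sum_sum_exp_mul_le (Mk (⟨d + 1, L, m, K, hd, hL⟩ : Params) j) hκ
    (rep (Mk (⟨d + 1, L, m, K, hd, hL⟩ : Params) j) (iterBlockOf j s)) hβ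
  have := mul_le_mul_of_nonneg_left hsum hC
  simp only [← Finset.mul_sum] at this ⊢
  simpa [mul_assoc, mul_comm, mul_left_comm] using this

/-! ## §4 Packaged: every `Params` of a given dimension, and the d = 3 carrier -/

/-- **PRINT'S `H` AT THE SETUP TORUS, PACKAGED** ([Balaban1985Variational] (45)–(46) «L^jηQ_jHB = B … |HB| ≦ B₀(L^jη)⁻¹|B|, |∇HB| ≦ B₀(L^jη)⁻²|B|», in
`η`-units, flat, `B₀ = B₀(d)`): for every `d ≥ 1` there is `C > 0` such that for every `P : Params` with `P.d = d` (any odd `L > 1`, volume `m`, run `K`)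
and every level `j ≤ m + K` there is a map `H` from real coarse bond fields on `T^{(j)}` to real fine bond fields on `T^{(0)}` with
(i) `Q_j(Hb) = b` (`bondAvgIter j`), (ii) `|(Hb)(c)| ≤ C·β` and (iii) `L^j·|(Hb)(⟨s+e_ν,μ⟩) − (Hb)(⟨s,μ⟩)| ≤ C·β` whenever `|b| ≤ β` — `H` being pub-balaban's
typed `H_k` of [B5] (1.63) read back through p16/p21's tower transports (`H b = tV⁻¹(pullR(H_k·cplx(tB b)))`, linear in `b`).
[cite: Balaban1984PropagatorsI, (1.63) p.28, p.29; Balaban1985Variational, (45)-(46) p.285] -/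
theorem exists_flatH (d : ℕ) (hd : 1 ≤ d) : ∃ C : ℝ, 0 < C ∧ ∀ (P : Params), P.d = d → ∀ (j : ℕ) (hj : j ≤ P.m + P.K),
    ∃ H : VecField P j ℝ → VecField P 0 ℝ, ∀ (b : VecField P j ℝ),
      bondAvgIter j (H b) = b ∧
      ∀ (β : ℝ), (∀ c', |b c'| ≤ β) →
        (∀ c : PBond P 0, |H b c| ≤ C * β) ∧
        (∀ (s : Site P 0) (μ ν : Fin P.d), (P.L : ℝ) ^ j * |H b ⟨s.shift ν, μ⟩ - H b ⟨s, μ⟩| ≤ C * β) := by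
  refine ⟨max (MG163 d * periodConst (kappa163 d) (d - 1) * (d * latticeConst d (kappa163 d / d)))
      (MD163 d * periodConst (kappa163 d) (d - 1) * (d * latticeConst d (kappa163 d / d))) + 1,
    add_pos_of_nonneg_of_pos (le_max_of_le_left (mul_nonneg (mul_nonneg (MG163_nonneg _) (periodConst_pos (kappa163_pos _) _).le)
      (mul_nonneg (Nat.cast_nonneg _) (latticeConst_nonneg _ (div_nonneg (kappa163_pos _).le (Nat.cast_nonneg _)))))) one_pos,
    fun P hPd j hj => ?_⟩
  subst hPd
  refine ⟨fun b => (tV hj).symm (pullR P.L (Mk P j) j (HkOp (P.L ^ j) (Mk P j) *ᵥ cplx (tB b))), fun b => ⟨bondAvgIter_H_eq hj b, ?_⟩⟩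
  intro β hb
  have hβ : 0 ≤ β := by
    obtain ⟨c⟩ : Nonempty (PBond P j) := ⟨⟨fun _ => 0, ⟨0, P.hd⟩⟩⟩
    exact (abs_nonneg _).trans (hb c)
  refine ⟨fun c => (abs_H_le hj b hb c).trans ?_, fun s μ ν => (abs_grad_H_le hj b hb s μ ν).trans ?_⟩
  · exact mul_le_mul_of_nonneg_right ((le_max_left _ _).trans (le_add_of_nonneg_right zero_le_one)) hβ
  · exact mul_le_mul_of_nonneg_right ((le_max_right _ _).trans (le_add_of_nonneg_right zero_le_one)) hβ

section T3

open T3ContinuumYM3Torus (T3Family)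

/-- The fine torus of run `K` of the T³ family sits `K − n` levels above the comparison lattice. [cite: Balaban1985UV3, (1)-(3) p.256] -/
theorem le_T3 (F : T3Family) (n K : ℕ) : K - n ≤ (F.P K).m + (F.P K).K := by
  show K - n ≤ F.m + K
  omega

/-- **PRINT'S `H` AT THE d = 3 CARRIER** (fine torus `Site (F.P K) 0`, coarse lattice `T^{(K−n)}`, factor `L^{K−n} = η⁻¹`): an ABSOLUTE `C > 0` and,
for every member `F`, heights `n, K`, a map `H` from real bond fields on `T^{(K−n)}` to real bond fields on the fine torus with `Q_{K−n}(Hb) = b`,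
`|Hb| ≤ C·β`, `L^{K−n}·|(Hb)(⟨s+e_ν,μ⟩) − (Hb)(⟨s,μ⟩)| ≤ C·β` for `|b| ≤ β` — the flat `H` of [Balaban1985Variational] (45)–(46) / Sect. F (160)–(161)
(«the function HB») for the V2′/V3 pillars, uniform in `L`, `m`, `n`, `K`. [cite: Balaban1985Variational, (45)-(46) p.285, Sect. F (161) p.302] -/
theorem exists_flatH_T3 : ∃ C : ℝ, 0 < C ∧ ∀ (F : T3Family) (n K : ℕ),
    ∃ H : VecField (F.P K) (K - n) ℝ → VecField (F.P K) 0 ℝ, ∀ (b : VecField (F.P K) (K - n) ℝ),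
      bondAvgIter (K - n) (H b) = b ∧
      ∀ (β : ℝ), (∀ c', |b c'| ≤ β) →
        (∀ c : PBond (F.P K) 0, |H b c| ≤ C * β) ∧
        (∀ (s : Site (F.P K) 0) (μ ν : Fin 3), (F.L : ℝ) ^ (K - n) * |H b ⟨s.shift ν, μ⟩ - H b ⟨s, μ⟩| ≤ C * β) := by
  obtain ⟨C, hC, h⟩ := exists_flatH 3 (by norm_num)
  exact ⟨C, hC, fun F n K => h (F.P K) rfl (K - n) (le_T3 F n K)⟩

end T3

end Summit.QuantumFields.YangMills.Theorems.FlatMinimizerH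

end
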